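import Summits.BirchSwinnertonDyer.Rank1Residual.X11b.BDPRouteSelmerFiniteRankOne
import Literature.Barriers.BirchSwinnertonDyer.DescentDefectUnboundedRankCalculus

/-! # Route `CongruentShaFreeCut` (rung S2) — crux `RankPosOfTwoSelmerCorankOne`
(stmt-BirchSwinnertonDyer-19079, the route's declared RESIDUAL), Link A in CORANK currency, part 2/3:
the two SUPPLIES of the corank-one level bound — the size of the local Kummer condition at a degree-one
prime, and LARGE SELMER GROUPS FROM THE CORANK (`corank_{ℤ_p} Sel_{p^∞}(E/K) = 1 ⟹ p^k ≤ #Sel^{(p^k)}(E/K)`)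

Cell `bsd-cn100`, prover seat `bsd-cn100-transfer-2` g3. Supports, does not close,
stmt-BirchSwinnertonDyer-19079. HONEST FRAMING: label (A) — Mathlib/tree theorems only (Mordell–Weil,
the Kummer sequence, the structure of `E(ℚ_p)`, the corank identity `corank Sel = rank + corank Ш`,
all PROVED in the tree), no named fact, no new definition; nothing about BSD, crux A/B or the leaf is
claimed. Consumed by part 3 (`…TwoAdicSelmerFiniteCorank`).

## What is proved

* `natCard_kummerSelmerStructure_le_torsion_mul_pow` — `#𝓛_𝔮^{(p^k)} ≤ #E(ℚ_p)_tors · p^k` at a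
  degree-one prime `𝔮 ∣ p` of `K` for an elliptic, globally minimal `W/ℚ` (`#𝓛_𝔮 = [E(K_𝔮) : p^k] =
  [E(ℚ_p) : p^k] = [E(ℚ_p) : T + p^k]·[T + p^k : p^k] ≤ p^k · #T`; X11b `LocalIndex`/`LocalIndexTransport`).
* `finite_sha_inf_torsionBy` — `Ш(E/K) ∩ H¹(K, E)[n]` is finite (image of the finite `Sel⁽ⁿ⁾`).
* `pow_le_natCard_sha_inf_torsionBy_of_shaCorank_eq_one` — `corank_{ℤ_p} Ш[p^∞] = 1 ⟹ p^k ≤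
  #(Ш ∩ H¹(K,E)[p^k])` (the `p`-primary group `Ш[p^∞]` with finite `p`-torsion contains a `p`-divisible
  subgroup of `p`-rank `≥ 1`, hence a copy of `ℤ/p^k`; tree `exists_pDivisible_nRankAtLeast_zpCorank`,
  `nRankAtLeast.pow_of_pDivisible` of the Matsuno barrier files).
* **`pow_le_natCard_selmerGroup_of_selmerCorank_eq_one`** — `corank_{ℤ_p} Sel_{p^∞}(E/K) = 1 ⟹
  p^k ≤ #Sel^{(p^k)}(E/K)` for every `k`: by the corank identity (`selmerCorank_eq_mordellWeilRank_add_holds`)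
  either `rank E(K) = 1` — then `E(K) ↠ ℤ/p^k` kills `p^kE(K)`, so `[E(K) : p^kE(K)] ≥ p^k` — or
  `corank Ш[p^∞] = 1`; and `#Sel^{(p^k)} = [E(K) : p^kE(K)] · #(Ш ∩ H¹(K,E)[p^k])` (tree
  `SelmerCount.natCard_selmerGroup_eq_index_mul`).

References: [SilvermanAEC2009] Thm. X.4.2, Prop. VII.6.3, Thm. VIII.6.7; [MilneADT2006] I Lemma 3.3;
[Greenberg1999] §1 (corank identity); [Matsuno2009] §2 (`rk_n`). -/

noncomputable section

open scoped Classical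

universe u

namespace Summit.BirchSwinnertonDyer.BirchSwinnertonDyer.Theorems.CongruentShaFreeCutTwoAdicSelmerCorankSupplies

open WeierstrassCurve NumberField IsDedekindDomain Field Function
open Literature.NumberTheory.EllipticCurves Literature.NumberTheory.EllipticCurves.GreenbergSelmer
open Literature.NumberTheory.GaloisRepresentations Literature.NumberTheory.GaloisCohomology
open Literature.NumberTheory.GaloisRepresentations.DiscreteGaloisModule (mu MuCarrier)
open Summit.BirchSwinnertonDyer.Rank1Residual.X11b
open Summit.BirchSwinnertonDyer.Rank1Residual.X11b.FiniteDuality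
open Summit.BirchSwinnertonDyer.Rank1Residual.X11b.Relaxation
open scoped ContRepresentation


/-! ## 1. Supplies: the local Kummer condition at a degree-one prime; large Selmer groups from the
corank -/

section Supplies

/-- **`#𝓛_𝔮^{(p^k)} ≤ #E(ℚ_p)_tors · p^k`** at a degree-one prime `𝔮 ∣ p` of `K` for a curve
`W/ℚ` (elliptic, globally minimal): `#𝓛_𝔮 = [E(K_𝔮) : p^kE(K_𝔮)] = [E(ℚ_p) : p^kE(ℚ_p)]`
(transport at a degree-one prime), and `[E(ℚ_p) : p^k] = [E(ℚ_p) : T + p^k]·[T + p^k : p^k] ≤ p^k · #T`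
(`E(ℚ_p) ⊇ ℤ_p` of finite index, `LocalIndex`). [cite: SilvermanAEC2009, Prop. VII.6.3]
[cite: MilneADT2006, Ch. I, Lemma 3.3] -/
theorem natCard_kummerSelmerStructure_le_torsion_mul_pow (W : WeierstrassCurve ℚ) [W.IsElliptic]
    [W.IsGloballyMinimal] (p : ℕ) [Fact p.Prime] (K : Type) [Field K] [NumberField K]
    (𝔮 : HeightOneSpectrum (𝓞 K)) (h𝔮 : ((p : ℕ) : 𝓞 K) ∈ 𝔮.asIdeal)
    (he : 𝔮.asIdeal.ramificationIdx (𝓞 ℚ) = 1) (hf : 𝔮.asIdeal.inertiaDeg (𝓞 ℚ) = 1) (k : ℕ) :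
    ∃ _ : Finite (AddCommGroup.torsion (W.baseChange ℚ_[p]).toAffine.Point),
      Nat.card ((W.baseChange K).kummerSelmerStructure ((p ^ k : ℕ) : ℤ) (Sum.inr 𝔮)) ≤
        Nat.card (AddCommGroup.torsion (W.baseChange ℚ_[p]).toAffine.Point) * p ^ k := by
  have hp : p.Prime := Fact.out
  haveI : NeZero (p ^ k) := ⟨pow_ne_zero _ hp.ne_zero⟩
  haveI : CharZero (𝔮.adicCompletion K) := charZero_adicCompletion 𝔮
  have hn : ((p ^ k : ℕ) : ℤ) ≠ 0 := Int.natCast_ne_zero.mpr (NeZero.ne _)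
  set G := W.baseChange ℚ_[p] with hGdef
  haveI hfi2 : (G.formalFiltration 2).FiniteIndex := G.finiteIndex_formalFiltration 2
  obtain ⟨φ, -⟩ := LocalIndex.exists_addEquiv_valuation_psi_padicPointOf W p (K := K)
  haveI hTG : Finite (AddCommGroup.torsion G.toAffine.Point) :=
    LocalIndex.finite_torsion (G.formalFiltration 2) φ
  refine ⟨hTG, ?_⟩
  set T : AddSubgroup G.toAffine.Point := AddCommGroup.torsion G.toAffine.Point with hT
  set P : AddSubgroup G.toAffine.Point := (nsmulAddMonoidHom (p ^ k) : G.toAffine.Point →+ _).range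
    with hP
  -- `#𝓛_𝔮 = [E(K_𝔮) : p^k] = [E(ℚ_p) : p^k] = P.index`
  have h1 : Nat.card ((W.baseChange K).kummerSelmerStructure ((p ^ k : ℕ) : ℤ) (Sum.inr 𝔮)) =
      P.index := by
    change Nat.card ((W.baseChange K).kummerLocalConditionAt ((p ^ k : ℕ) : ℤ) (𝔮.adicCompletion K)) = _
    rw [(W.baseChange K).natCard_kummerLocalConditionAt_eq_index (𝔮.adicCompletion K) hn,
      LocalIndexTransport.index_range_zsmul_eq_padic K p 𝔮 h𝔮 he hf W,
      RankOne.range_zsmulAddGroupHom_natCast]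
  -- `[G : T ⊔ P] = p^k`
  have h2 : (T ⊔ P).index = p ^ k := LocalIndex.index_torsion_sup_range_nsmul (G.formalFiltration 2) φ k
  -- `P.index = [T ⊔ P : P]·[G : T ⊔ P] ≤ #T · p^k`
  have h3 : P.relIndex (T ⊔ P) * (T ⊔ P).index = P.index := AddSubgroup.relIndex_mul_index le_sup_right
  have h4 : P.relIndex (T ⊔ P) ≤ Nat.card T := by
    rw [AddSubgroup.relIndex_sup_right]
    have h := AddSubgroup.card_mul_index (P.addSubgroupOf T)
    exact Nat.le_of_dvd Nat.card_pos (Dvd.intro_left _ h)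
  rw [h1, ← h3, h2]
  exact Nat.mul_le_mul_right _ h4

variable {K : Type} [Field K] [NumberField K] (E : WeierstrassCurve K) [E.IsElliptic] (p : ℕ)
  [Fact p.Prime]

/-- `Ш(E/K) ∩ H¹(K, E)[n]` is finite for `n ≠ 0`: it is the image of the finite `Sel⁽ⁿ⁾(E/K)`
(`map_torsionH1ToH1_selmerGroup_holds`, `finite_selmerGroup_holds`). [cite: SilvermanAEC2009, Thm. X.4.2] -/
theorem finite_sha_inf_torsionBy {n : ℤ} (hn : n ≠ 0) :
    Finite ↥(E.sha ⊓ AddSubgroup.torsionBy E.galH1 n) := by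
  haveI : Finite (selmerGroup E n) := E.finite_selmerGroup_holds hn
  rw [← E.map_torsionH1ToH1_selmerGroup_holds hn]
  exact Finite.of_surjective
    (fun x : selmerGroup E n ↦ (⟨torsionH1ToH1 E n x, x, x.2, rfl⟩ :
      ↥((selmerGroup E n).map (torsionH1ToH1 E n))))
    (by rintro ⟨_, x, hx, rfl⟩; exact ⟨⟨x, hx⟩, rfl⟩)

/-- **`p^k ≤ #(Ш ∩ H¹(K, E)[p^k])` when `corank_{ℤ_p} Ш(E/K)[p^∞] = 1`**: the `p`-primary group
`Ш[p^∞]` (with finite `p`-torsion) contains a `p`-divisible subgroup `D` with `rk_p D ≥ 1`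
(`exists_pDivisible_nRankAtLeast_zpCorank`), hence a copy of `ℤ/p^k` (`nRankAtLeast.pow_of_pDivisible`),
which lies in `Ш ∩ H¹(K, E)[p^k]`. [folklore] -/
theorem pow_le_natCard_sha_inf_torsionBy_of_shaCorank_eq_one (hsha : E.shaCorank p = 1) (k : ℕ) :
    p ^ k ≤ Nat.card ↥(E.sha ⊓ AddSubgroup.torsionBy E.galH1 ((p ^ k : ℕ) : ℤ)) := by
  have hp : p.Prime := Fact.out
  haveI : NeZero (p ^ k) := ⟨pow_ne_zero _ hp.ne_zero⟩
  haveI hfin : Finite ↥(E.sha ⊓ AddSubgroup.torsionBy E.galH1 ((p ^ k : ℕ) : ℤ)) :=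
    finite_sha_inf_torsionBy E (Int.natCast_ne_zero.mpr (NeZero.ne _))
  rcases Nat.eq_zero_or_pos k with rfl | hk
  · exact (pow_zero p).le.trans (Nat.one_le_iff_ne_zero.mpr Nat.card_pos.ne')
  set A := AddCommGroup.primaryComponent E.sha p with hA
  have hprim : ∀ a : A, ∃ m : ℕ, p ^ m • a = 0 := fun a ↦ by
    obtain ⟨m, hm⟩ := (AddCommGroup.mem_primaryComponent).mp a.2
    exact ⟨m, Subtype.ext hm⟩
  haveI : Finite (AddSubgroup.torsionBy E.sha (p : ℤ)) :=
    E.finite_sha_torsionBy_holds (p : ℤ) (by exact_mod_cast hp.ne_zero)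
  haveI : Finite (AddSubgroup.torsionBy A (p : ℤ)) := by
    refine Finite.of_injective (fun x : AddSubgroup.torsionBy A (p : ℤ) ↦
      (⟨((x : A) : E.sha), ?_⟩ : AddSubgroup.torsionBy E.sha (p : ℤ))) ?_
    · have hx : (p : ℤ) • (x : A) = 0 := x.2
      exact congrArg Subtype.val hx
    · intro x y hxy
      have hval := congrArg Subtype.val hxy
      exact Subtype.ext (Subtype.ext hval)
  obtain ⟨D, hDdiv, hDrank⟩ :=
    Literature.Barriers.BirchSwinnertonDyer.exists_pDivisible_nRankAtLeast_zpCorank (p := p) A hprim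
  have hcork : zpCorank A p = 1 := hsha
  rw [hcork] at hDrank
  have hDdiv' : ∀ x : D, ∃ y : D, p • y = x := fun x ↦ by
    obtain ⟨y, hy, hyx⟩ := hDdiv x x.2
    exact ⟨⟨y, hy⟩, Subtype.ext hyx⟩
  obtain ⟨f, hf⟩ :=
    Literature.Barriers.BirchSwinnertonDyer.nRankAtLeast.pow_of_pDivisible (p := p) hDdiv' hDrank
      (N := k) hk
  -- the copy of `ℤ/p^k` inside `Ш ∩ H¹(K,E)[p^k]`
  let g : (Fin 1 → ZMod (p ^ k)) → ↥(E.sha ⊓ AddSubgroup.torsionBy E.galH1 ((p ^ k : ℕ) : ℤ)) :=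
    fun y ↦ ⟨(((f y : D) : A) : E.sha), ((((f y : D) : A) : E.sha)).2, by
      have h0 : (p ^ k) • y = 0 := by
        funext i; simp
      have h1 : (p ^ k) • f y = 0 := by rw [← map_nsmul, h0, map_zero]
      have h2 : ((p ^ k : ℕ) : ℤ) • ((((f y : D) : A) : E.sha) : E.galH1) = 0 := by
        rw [natCast_zsmul]
        have := congrArg (fun z : D => ((((z : D) : A) : E.sha) : E.galH1)) h1
        simpa using this
      exact h2⟩
  have hg : Function.Injective g := by
    intro y y' h
    have h' : ((((f y : D) : A) : E.sha) : E.galH1) = ((((f y' : D) : A) : E.sha) : E.galH1) :=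
      congrArg (fun z : ↥(E.sha ⊓ AddSubgroup.torsionBy E.galH1 ((p ^ k : ℕ) : ℤ)) => (z : E.galH1)) h
    exact hf (Subtype.ext (Subtype.ext (Subtype.ext h')))
  calc p ^ k = Nat.card (Fin 1 → ZMod (p ^ k)) := by
        rw [Nat.card_fun, Nat.card_zmod, Nat.card_eq_fintype_card, Fintype.card_fin, pow_one]
    _ ≤ _ := Nat.card_le_card_of_injective g hg

/-- **`p^k ≤ #Sel^{(p^k)}(E/K)` when `corank_{ℤ_p} Sel_{p^∞}(E/K) = 1`.** By the corank identity
(`selmerCorank_eq_mordellWeilRank_add_holds`) either `rank E(K) = 1` — then `E(K) ↠ ℤ/p^k`, so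
`[E(K) : p^kE(K)] ≥ p^k` — or `corank Ш[p^∞] = 1` — then `#(Ш ∩ H¹(K,E)[p^k]) ≥ p^k`; and
`#Sel^{(p^k)} = [E(K) : p^kE(K)] · #(Ш ∩ H¹(K,E)[p^k])` (Kummer sequence, tree
`SelmerCount.natCard_selmerGroup_eq_index_mul`). [cite: SilvermanAEC2009, Thm. X.4.2] -/
theorem pow_le_natCard_selmerGroup_of_selmerCorank_eq_one (hcork : E.selmerCorank p = 1) (k : ℕ) :
    p ^ k ≤ Nat.card (selmerGroup E ((p ^ k : ℕ) : ℤ)) := by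
  have hp : p.Prime := Fact.out
  haveI : NeZero (p ^ k) := ⟨pow_ne_zero _ hp.ne_zero⟩
  have hn : ((p ^ k : ℕ) : ℤ) ≠ 0 := Int.natCast_ne_zero.mpr (NeZero.ne _)
  haveI : Finite (selmerGroup E ((p ^ k : ℕ) : ℤ)) := E.finite_selmerGroup_holds hn
  haveI := finite_sha_inf_torsionBy E hn
  have hadd := E.selmerCorank_eq_mordellWeilRank_add_holds p
  rw [hcork] at hadd
  have hSel := SelmerCount.natCard_selmerGroup_eq_index_mul E hn
  have hSelpos : 0 < Nat.card (selmerGroup E ((p ^ k : ℕ) : ℤ)) := Nat.card_pos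
  set H : AddSubgroup E.toAffine.Point :=
    ((zsmulAddGroupHom ((p ^ k : ℕ) : ℤ) : E.toAffine.Point →+ _).range) with hH
  have hHne : H.index ≠ 0 := fun h0 ↦ by
    rw [hSel, h0, zero_mul] at hSelpos
    exact lt_irrefl 0 hSelpos
  have hSha1 : 1 ≤ Nat.card ↥(E.sha ⊓ AddSubgroup.torsionBy E.galH1 ((p ^ k : ℕ) : ℤ)) :=
    Nat.one_le_iff_ne_zero.mpr Nat.card_pos.ne'
  rw [hSel]
  rcases Nat.eq_zero_or_pos (E.mordellWeilRank) with h0 | hpos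
  · -- `corank Ш[p^∞] = 1`
    have hsha : E.shaCorank p = 1 := by omega
    calc p ^ k = 1 * p ^ k := (one_mul _).symm
      _ ≤ _ := Nat.mul_le_mul (Nat.one_le_iff_ne_zero.mpr hHne)
          (pow_le_natCard_sha_inf_torsionBy_of_shaCorank_eq_one E p hsha k)
  · -- `rank E(K) = 1`: `E(K) ↠ ℤ/p^k` kills `p^kE(K)`
    have hrank : E.mordellWeilRank = 1 := by omega
    obtain ⟨c, Q, hcQ, -⟩ := RankOne.exists_coord_of_mordellWeilRank_eq_one E hrank
    set φ : E.toAffine.Point →+ ZMod (p ^ k) := (Int.castAddHom (ZMod (p ^ k))).comp c with hφ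
    have hφs : Function.Surjective φ :=
      (ZMod.intCast_surjective (n := p ^ k)).comp (RankOne.coord_surjective c Q hcQ)
    have hle : H ≤ φ.ker := by
      rintro _ ⟨y, rfl⟩
      rw [AddMonoidHom.mem_ker, zsmulAddGroupHom_apply]
      change (((c (((p ^ k : ℕ) : ℤ) • y) : ℤ)) : ZMod (p ^ k)) = 0
      rw [map_zsmul, smul_eq_mul, Int.cast_mul, Int.cast_natCast, ZMod.natCast_self, zero_mul]
    have hkidx : φ.ker.index = p ^ k := by
      rw [AddSubgroup.index_ker, AddMonoidHom.range_eq_top.mpr hφs, AddSubgroup.card_top, Nat.card_zmod]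
    have hmul : H.relIndex φ.ker * φ.ker.index = H.index := AddSubgroup.relIndex_mul_index hle
    have hrel : H.relIndex φ.ker ≠ 0 := fun h ↦ hHne (by rw [← hmul, h, zero_mul])
    have hidx : p ^ k ≤ H.index := by
      rw [← hmul, hkidx]
      exact Nat.le_mul_of_pos_left _ (Nat.pos_of_ne_zero hrel)
    calc p ^ k = p ^ k * 1 := (mul_one _).symm
      _ ≤ _ := Nat.mul_le_mul hidx hSha1

end Supplies

end Summit.BirchSwinnertonDyer.BirchSwinnertonDyer.Theorems.CongruentShaFreeCutTwoAdicSelmerCorankSupplies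

end
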